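import Summits.QuantumFields.YangMills.Theorems.BalabanUVNodesN15KingModelMasslessLimit

/-!
# BalabanUVNodes ∕ N15 — THE KING-MODEL RUNG (PART Ϻ-gg): THE MASS IS A FAITHFUL PARAMETER — `S₂^{ℝ}_{m²}(z)` is STRICTLY decreasing in `m²`, `S₂^{ℝ}_{m²} < S₂^{0}`, so King's
# infinite-volume block fields `μ_{∞,m²}` (`m² > 0`) are pairwise distinct and distinct from the massless `μ⁰_∞` — prerequisites for "the RG flow `m ↦ Lm` has no massive fixed point"
# (Track A, DAG node N15 = NE2; FAN-OUT v1.1 §N15 s3 «KING-MODEL RUNG»; count-neutral)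

HONEST FRAMING.  Count-neutral (cell `pub-ymgap`, seat `pub-ymgap-dag-n15-e` g35; `--supports stmt-QuantumFields-27366 --as helper` = K3⁸).  King's `A = 0`, `g = 0` model
([King1986] C. King, Commun. Math. Phys. **102** (1986) 649–677).  Part Ϻ-m proved `S₂^{ℝ}` antitone in the mass; in proper time `S₂^{ℝ}_{m²}(z) = (2π)^{−(d+1)}∫₀^∞e^{−tm²}Π_μj_t(z_μ)dt`
with `Π_μj_t(z_μ) > 0`, so the dependence is STRICT: ★★ `m₁² < m₂² ⇒ S₂^{ℝ}_{m₂²}(z) < S₂^{ℝ}_{m₁²}(z)` for every `z`; hence ★ `S₂^{ℝ}_{m²}(z) < S₂^{0}(z)` (`d ≥ 2`), ★★ `m₁² ≠ m₂² ⇒ μ_{∞,m₁²} ≠ μ_{∞,m₂²}`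
(their covariances at `0` differ) and ★ `μ_{∞,m²} ≠ μ⁰_∞`: the mass parametrises King's free block fields faithfully.  NOT Bałaban's objects; NOT a node discharge; nothing continuum-YM ∕ OS ∕ Clay.
0 `sorry`, 0 def; standard axioms.

WHAT THIS FILE PROVES (kernel).  §1 `prod_lineHeat_pos`, ★★ **`kingS2Inf_strictAnti_mass`**, `kingS2Inf_injective_mass`.  §2 ★ `kingS2Inf_lt_kingS2Inf0`.  §3 ★★ **`kingFieldInf_ne_of_ne`**,
★ `kingFieldInf_ne_kingFieldInf0`.

HONEST SCOPE.  King's free block fields at infinite volume.  N15 untouched; counts unmoved.  Locators (use): [King1986] Thm 2.1 (2.22) p.654, (4.5) p.670.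
-/

noncomputable section

open scoped BigOperators Topology
open Filter MeasureTheory Set

namespace Summit.QuantumFields.YangMills.BalabanUVNodes.N15KingModelRung.ProperTime

open Summit.QuantumFields.YangMills.BalabanUVNodes.N15KingModelRung.OptimalDecay

variable {d : ℕ}

/-! ## §1 Strict monotonicity in the mass -/

/-- `Π_μj_t(z_μ) > 0` for `t > 0`. [folklore] -/
theorem prod_lineHeat_pos {t : ℝ} (ht : 0 < t) (z : Fin (d + 1) → ℤ) : 0 < ∏ μ, lineHeat t (z μ) :=
  Finset.prod_pos fun _ _ => lineHeat_pos ht _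

/-- ★★ **`S₂^{ℝ}` IS STRICTLY DECREASING IN THE MASS**: `0 < m₁² < m₂² ⇒ S₂^{ℝ}_{m₂²}(z) < S₂^{ℝ}_{m₁²}(z)` for every `z`. [cite: King1986, Thm 2.1 (2.22) p.654, (4.5) p.670] -/
theorem kingS2Inf_strictAnti_mass {m1 m2 : ℝ} (h1 : 0 < m1) (h12 : m1 < m2) (z : Fin (d + 1) → ℤ) : kingS2Inf m2 z < kingS2Inf m1 z := by
  have h2 : 0 < m2 := h1.trans h12
  rw [kingS2Inf_eq_integral_properTime h2 z, kingS2Inf_eq_integral_properTime h1 z]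
  refine mul_lt_mul_of_pos_left ?_ (by positivity)
  rw [← sub_pos, ← integral_sub (integrableOn_properTime h1 z) (integrableOn_properTime h2 z)]
  have hnn : ∀ t ∈ Ioi (0 : ℝ), 0 < Real.exp (-(t * m1)) * ∏ μ, lineHeat t (z μ) - Real.exp (-(t * m2)) * ∏ μ, lineHeat t (z μ) := by
    intro t ht
    have ht : 0 < t := ht
    rw [← sub_mul]
    exact mul_pos (sub_pos.mpr (Real.exp_lt_exp.mpr (by nlinarith))) (prod_lineHeat_pos ht z)
  rw [setIntegral_pos_iff_support_of_nonneg_ae]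
  · have hsupp : Ioi (0 : ℝ) ⊆ Function.support (fun t : ℝ => Real.exp (-(t * m1)) * ∏ μ, lineHeat t (z μ) - Real.exp (-(t * m2)) * ∏ μ, lineHeat t (z μ)) :=
      fun t ht => (hnn t ht).ne'
    rw [inter_eq_self_of_subset_right hsupp]
    simp
  · filter_upwards [ae_restrict_mem measurableSet_Ioi] with t ht
    exact (hnn t ht).le
  · exact (integrableOn_properTime h1 z).sub (integrableOn_properTime h2 z)

/-- `m² ↦ S₂^{ℝ}_{m²}(z)` is injective on `(0,∞)`. [folklore] -/
theorem kingS2Inf_injective_mass {m1 m2 : ℝ} (h1 : 0 < m1) (h2 : 0 < m2) (z : Fin (d + 1) → ℤ) (h : kingS2Inf m1 z = kingS2Inf m2 z) : m1 = m2 := by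
  rcases lt_trichotomy m1 m2 with hlt | heq | hgt
  · exact absurd h (kingS2Inf_strictAnti_mass h1 hlt z).ne'
  · exact heq
  · exact absurd h (kingS2Inf_strictAnti_mass h2 hgt z).ne

end Summit.QuantumFields.YangMills.BalabanUVNodes.N15KingModelRung.ProperTime

namespace Summit.QuantumFields.YangMills.BalabanUVNodes.N15KingModelRung.InfiniteVolume

open Summit.QuantumFields.YangMills.BalabanUVNodes.N15KingModelRung.OptimalDecay
open Summit.QuantumFields.YangMills.BalabanUVNodes.N15KingModelRung.ProperTime

variable {d : ℕ}

/-! ## §2 The massless two-point function strictly dominates -/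

/-- ★ `S₂^{ℝ}_{m²}(z) < S₂^{0}(z)` for every `m² > 0` (`d ≥ 2`). [folklore] -/
theorem kingS2Inf_lt_kingS2Inf0 (hd : 2 ≤ d) {m2 : ℝ} (hm : 0 < m2) (z : Fin (d + 1) → ℤ) : kingS2Inf m2 z < kingS2Inf0 z :=
  (kingS2Inf_strictAnti_mass (half_pos hm) (half_lt_self hm) z).trans_le (kingS2Inf_le_kingS2Inf0 hd (half_pos hm) z)

/-! ## §3 Distinct masses give distinct laws -/

/-- ★★ **THE MASS PARAMETRISES KING'S BLOCK FIELDS FAITHFULLY**: `m₁² ≠ m₂² ⇒ μ_{∞,m₁²} ≠ μ_{∞,m₂²}` (their variances `∫φ(0)²` differ). [cite: King1986, Thm 2.1 (2.22) p.654] -/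
theorem kingFieldInf_ne_of_ne {m1 m2 : ℝ} (h1 : 0 < m1) (h2 : 0 < m2) (hne : m1 ≠ m2) : kingFieldInf (d := d) m1 ≠ kingFieldInf m2 := by
  intro h
  have e1 := integral_eval_mul_eval_kingFieldInf (d := d) h1 0 0
  have e2 := integral_eval_mul_eval_kingFieldInf (d := d) h2 0 0
  rw [h] at e1
  rw [e1, sub_self] at e2
  exact hne (kingS2Inf_injective_mass h1 h2 _ e2)

/-- ★ The massive fields differ from the massless one: `μ_{∞,m²} ≠ μ⁰_∞` (`d ≥ 2`). [folklore] -/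
theorem kingFieldInf_ne_kingFieldInf0 (hd : 2 ≤ d) {m2 : ℝ} (hm : 0 < m2) : kingFieldInf (d := d) m2 ≠ kingFieldInf0 d := by
  intro h
  have e1 := integral_eval_mul_eval_kingFieldInf (d := d) hm 0 0
  have e2 := integral_eval_mul_eval_kingFieldInf0 hd (0 : Fin (d + 1) → ℤ) 0
  rw [h] at e1
  rw [e1, sub_self] at e2
  exact (kingS2Inf_lt_kingS2Inf0 hd hm _).ne e2

end Summit.QuantumFields.YangMills.BalabanUVNodes.N15KingModelRung.InfiniteVolume
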